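import Summits.QuantumFields.BalabanUV.T4Continuum.Support.NE7EtaPlaquetteClosenessTorus
import Summits.QuantumFields.BalabanUV.T4Continuum.Support.NE7EtaGradientFromEnergy
import Summits.QuantumFields.BalabanUV.T4Continuum.Support.NE3LocalCrudeRate

/-!
# NE7EtaRatesD4 — route #1 of the NE7 crux, hardest stub S1∕L7b-background: the GEOMETRIC RATES IN THE KERNEL —
# the cube constraints of the three gen-21 displays SOLVED at `d = 4` with `θ⁶ = L⁻¹`, explicit constants, the fit threshold
# (rider R1-k₁) and the geometric-majorant bookkeeping the tower composition consumes

Cell `pub-balaban`, rung (B)+1 sub-cell t4, lineage `b2b-balaban-t4-ne7-p1`, generation 22 (CRUX PROVER NE7 #1, ruling e34b3e0c); crux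
skeleton `t4/skeletons/NE7-CRUX-R1.md` v1.5.3 §3bis (currency census) → v1.6.  Sequel of `NE7EtaSupFromEnergyTorus` (p250077),
`NE7EtaGradientFromEnergy` (p250680), `NE7EtaPlaquetteClosenessTorus` (p250428).  HONEST FRAMING (page 1): FIXED FINITE T⁴, rung (B)+1;
NE7, NE3 NOT PRINTED in [Balaban1984PropagatorsI]–[Balaban1989LargeFieldII] and NOT PROVED here; continuum YM on T⁴ ⇐ BetaPertH ∧ nine
spine estimates (0/9 proved); BetaPertH ⇐ (D1) ∧ (D4) ∧ CAP+tail; G-an2-4 gates asym, D1 and NE2/3/4; NOT infinite volume, NOT mass gap,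
NOT Clay.

WHAT.  The gen-21 files bound the two-run discrepancy direction `Z` (run A's gauge-fixed minimiser `= vary W Z 1`, `W` the
once-averaged run-B minimiser) POINTWISE in every coordinate of the U-slot currency ([Balaban1987RG1] p. 262 (1.13)–(1.14)), but with
the cube data `a, b, a′, b′` FREE under constraints (`8λ ≤ a³`, `L^k·E ≤ b³`, `b∕a + 1 ≤ N L^k`, …) and the exponent count in PROSE.
THIS FILE solves the constraints once and for all.  Write `θ⁶ = L⁻¹` (so `ξ := (L⁻¹)^k = θ^{6k}`, `ξ² = θ^{12k}`), let ONE `N L^k`-periodic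
pair `(W, Z)` on `ℤ⁴` satisfy
  (E)     `L^k · energyNormW L k W Z (periodBox (N L^k)) ≤ γ³`   (T-E_w's energy conjunct at `d = 4`: `L^k·C·R_k ≤ C·ρ₄` is k-FREE by
          `NE3LocalCrudeRate.residualScale_four_le`; `energy_budget_of_residualScale` below),
  (Lip₁)  `‖Z (x + e μ) κ − Z x κ‖ ≤ Λ₁·ξ²`, `Λ₁ ≤ l₁³`;   (Lip₂) `‖d_W Z (x + e μ, π) − d_W Z (x, π)‖ ≤ Λ₂·ξ³`, `Λ₂ ≤ l₂³`;
  (Lip₂′) second differences of `Z(·, κ)` `≤ Λ₂′·ξ³`, `Λ₂′ > 0`;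
  (FIT)   `γ·θ^{2k} ≤ l·N` (`l = l₁` resp. `l₂`), `k ≥ 1`, `L ≥ 2` (so `θ^{6k} ≤ 1∕2`).
Then (§2): **`norm_dir_le_rate`** `‖Z x κ‖ ≤ 8l₁²γ·θ^{8k}`; **`norm_curl_le_rate`** `‖d_W Z (x, π)‖ ≤ 8l₂²γ·θ^{14k}`;
**`norm_dirDiff_le_rate`** `‖Z (x + e μ) κ − Z x κ‖ ≤ 4l₁√(2γΛ₂′)·θ^{13k}`; **`norm_hol_sub_le_rate`** (W unitary, Z skew)
`‖(W e^Z)(∂p) − W(∂p)‖ ≤ (8l₂²γ + 1536·l₁⁴γ²·e^{8l₁²γ})·θ^{14k}` — the exponential factor now takes OUR sup bound, so the sup conjunct of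
T-E_w♯ is NO LONGER an input of route 1 (the re-typed INTERFACE REQUEST NE7→NE3 asks T-E_w + (Lip₁)(Lip₂)(Lip₂′) only).
Against the margins (`α₀ξ² = α₀θ^{12k}` for plaquettes and curls, `ξ = θ^{6k}` for the field-unit potential `a = Z∕ξ`, `ξ²` for its
gradient): ratios `θ^{2k}`, `θ^{2k}`, `θ^{2k}`, `θ^{k}` — GEOMETRIC, `θ = L^{−1/6}`.
§1 supplies the generic pieces: `exists_sixth_root` (`θ`), `fit_cube` (FIT ⇒ the cube fits), **`exists_fit_threshold`** (FIT holds for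
all `k ≥ k₁` — rider R1-k₁ of refuter PRICING-NE7 v3 §16), **`exists_geometric_majorant`** (`δ K ≤ Cθ^K` for `K ≥ k₁` ⇒ `δ K ≤ C₃θ^K`
for ALL `K` — the shape `T4TowerRateComposition.argBracket_tower` consumes; the finitely many early cutoffs ride in the constant).
§3: `energy_budget_of_residualScale` (T-E_w's `E ≤ C·R_k` ⇒ (E) with `γ³ = C·ρ₄`).
HONEST.  Elementary real analysis over the gen-21 junction lemmas ([folklore]); (E), (Lip₁), (Lip₂), (Lip₂′) are HYPOTHESES on ONE pair
— row NE3's re-typed root (WAKE-1, theorem unseated) is what would supply them for Bałaban's minimisers; the α₁(g_k)-loss of the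
(1.13) radius is the consumer's `PolyLipGrowth` on `CU`, not touched; NODE O's carrier untouched (reading condition: the (1.13) gradient
is the COVARIANT one `∇_W`, equal to the plain difference bounded here up to `2‖W − 1‖·‖Z‖` in the root's gauge); nothing of NE3∕NE7
discharged; 0 def; 0 sorry; nothing printed is a hypothesis of a theorem.
-/

set_option autoImplicit false

open scoped BigOperators Matrix Matrix.Norms.L2Operator
open Finset

namespace Summit.QuantumFields.BalabanUV.T4Continuum.NE7EtaRatesD4

open Literature.MathematicalPhysics.QuantumFieldTheory.Balaban1983to89
open B7Prop1Explicit B7Prop2Explicit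
open T4AveragingDeficitWall hiding Site Plane Plaq Bond
open T4AveragingDeficitWallBoundary (periodBox IsPeriodicCfg)
open AveragingDeficitPeriodicCounting (IsPeriodicDir)
open NE3EnergyShapes (residualScale residualScale_nonneg)
open NE3EnergyWeightedShapes (energyNormW energyNormW_nonneg)
open NE3HessContinuity (bondL1At bondL1At_nonneg)
open NE3EnergySmallFieldCurl (norm_hol_vary_sub_hol_le_curl)
open NE3LocalCrudeRate (residualScale_four_le)
open AveragingDeficitDualResidual (dualC1 dualC2)
open AveragingDeficitDerivWallProof (wallConst wallConst_nonneg)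
open NE7EtaSupFromEnergyTorus (norm_dir_le_of_energyNormW_periodic norm_curl_le_of_energyNormW_periodic)
open NE7EtaPlaquetteClosenessTorus (le_opt_of_two_term)
open NE7EtaGradientFromEnergy (norm_fwdDiff_le_two_sqrt)

noncomputable section

/-! ## §1 Generic pieces: the sixth root, the fit, the threshold, the geometric majorant -/

section Generic

/-- THE RATE BASE: for `L ≥ 2` there is `θ ∈ (0, 1)` with `θ⁶ = L⁻¹` (`θ = L^{−1/6}`). [folklore] -/
theorem exists_sixth_root {L : ℕ} (hL : 2 ≤ L) : ∃ θ : ℝ, 0 < θ ∧ θ < 1 ∧ θ ^ 6 = ((L : ℝ))⁻¹ := by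
  have hL0 : (0 : ℝ) < (L : ℝ) := by exact_mod_cast (by omega : 0 < L)
  have hinv0 : 0 < ((L : ℝ))⁻¹ := inv_pos.mpr hL0
  have hinv1 : ((L : ℝ))⁻¹ < 1 := inv_lt_one_of_one_lt₀ (by exact_mod_cast (by omega : 1 < L))
  refine ⟨((L : ℝ))⁻¹ ^ ((6 : ℕ)⁻¹ : ℝ), Real.rpow_pos_of_pos hinv0 _, ?_, ?_⟩
  · exact Real.rpow_lt_one hinv0.le hinv1 (by norm_num)
  · exact Real.rpow_inv_natCast_pow hinv0.le (by norm_num)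

/-- `θ⁶ = L⁻¹` ⇒ `(L⁻¹)^k = (θ^k)⁶` and `L^k·(θ^k)⁶ = 1` (`L ≥ 1`). [folklore] -/
theorem scale_eq {L : ℕ} (hL : 1 ≤ L) {θ : ℝ} (hθ6 : θ ^ 6 = ((L : ℝ))⁻¹) (k : ℕ) :
    ((L : ℝ)⁻¹) ^ k = (θ ^ k) ^ 6 ∧ (L : ℝ) ^ k * (θ ^ k) ^ 6 = 1 := by
  have hL0 : (L : ℝ) ≠ 0 := by exact_mod_cast (by omega : L ≠ 0)
  have h1 : ((L : ℝ)⁻¹) ^ k = (θ ^ k) ^ 6 := by rw [← pow_mul, mul_comm, pow_mul, hθ6]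
  refine ⟨h1, ?_⟩
  rw [← h1, ← mul_pow, mul_inv_cancel₀ hL0, one_pow]

/-- `θ⁶ = L⁻¹`, `L ≥ 2`, `k ≥ 1` ⇒ `(θ^k)⁶ ≤ 1∕2` and `θ^k ≤ 1`. [folklore] -/
theorem scale_le_half {L : ℕ} (hL : 2 ≤ L) {θ : ℝ} (hθ : 0 < θ) (hθ6 : θ ^ 6 = ((L : ℝ))⁻¹) {k : ℕ} (hk : 1 ≤ k) :
    (θ ^ k) ^ 6 ≤ 1 / 2 ∧ θ ^ k ≤ 1 := by
  have hL2 : (2 : ℝ) ≤ (L : ℝ) := by exact_mod_cast hL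
  obtain ⟨h1, -⟩ := scale_eq (by omega : 1 ≤ L) hθ6 k
  have hinv : ((L : ℝ))⁻¹ ≤ 1 / 2 := by rw [one_div]; exact inv_anti₀ (by norm_num) hL2
  have hinv0 : 0 ≤ ((L : ℝ))⁻¹ := by positivity
  constructor
  · rw [← h1]
    calc ((L : ℝ)⁻¹) ^ k ≤ ((L : ℝ)⁻¹) ^ 1 := pow_le_pow_of_le_one hinv0 (hinv.trans (by norm_num)) hk
      _ ≤ 1 / 2 := by rw [pow_one]; exact hinv
  · have hθ1 : θ ≤ 1 := by
      by_contra h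
      push Not at h
      have : (1 : ℝ) < θ ^ 6 := one_lt_pow₀ h (by norm_num)
      rw [hθ6] at this
      linarith
    exact pow_le_one₀ hθ.le hθ1

/-- **THE CUBE FITS**: `s = θ^k > 0`, `L^k·s⁶ = 1`, `s⁶ ≤ 1∕2`, `N ≥ 1`, `l > 0` and the FIT `γ·s² ≤ l·N` give
`γ∕(2·l·s⁴) + 1 ≤ N·L^k` — the hypothesis `b∕a + 1 ≤ P` of the optimised displays with `a = 2ls⁴`, `b = γ` (potential coordinate) or
`a = 2ls⁶`, `b = γs²` (curl coordinate, same quotient). [folklore] -/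
theorem fit_cube {L N k : ℕ} (hN : 1 ≤ N) {s γ l : ℝ} (hs : 0 < s) (hl : 0 < l) (hLs : (L : ℝ) ^ k * s ^ 6 = 1)
    (hhalf : s ^ 6 ≤ 1 / 2) (hfit : γ * s ^ 2 ≤ l * N) : γ / (2 * l * s ^ 4) + 1 ≤ ((N * L ^ k : ℕ) : ℝ) := by
  have hN1 : (1 : ℝ) ≤ N := by exact_mod_cast hN
  have hs6 : 0 < s ^ 6 := pow_pos hs 6
  have hLk : ((N * L ^ k : ℕ) : ℝ) = (N : ℝ) * (s ^ 6)⁻¹ := by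
    push_cast; rw [eq_inv_of_mul_eq_one_left hLs]
  rw [hLk, le_mul_inv_iff₀ hs6]
  have h2l : 0 < 2 * l * s ^ 4 := by positivity
  have e1 : (γ / (2 * l * s ^ 4) + 1) * s ^ 6 = γ * s ^ 2 / (2 * l) + s ^ 6 := by
    field_simp
  rw [e1]
  have h3 : γ * s ^ 2 / (2 * l) ≤ (N : ℝ) / 2 := by
    rw [div_le_div_iff₀ (by positivity) (by norm_num)]; nlinarith
  linarith

/-- **THE FIT THRESHOLD (rider R1-k₁)**: for `0 ≤ θ < 1` and any `γ`, `B > 0` there is `k₁` with `γ·(θ^k)² ≤ B` for all `k ≥ k₁`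
— the finitely many cutoffs below `k₁` need no closeness (they ride in the volume constant, `exists_geometric_majorant`). [folklore] -/
theorem exists_fit_threshold {θ : ℝ} (hθ0 : 0 ≤ θ) (hθ1 : θ < 1) (γ : ℝ) {B : ℝ} (hB : 0 < B) :
    ∃ k₁ : ℕ, ∀ k, k₁ ≤ k → γ * (θ ^ k) ^ 2 ≤ B := by
  by_cases hγ : γ ≤ 0
  · exact ⟨0, fun k _ => (mul_nonpos_of_nonpos_of_nonneg hγ (sq_nonneg _)).trans hB.le⟩
  push Not at hγ
  obtain ⟨m, hm⟩ := exists_pow_lt_of_lt_one (div_pos hB hγ) hθ1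
  refine ⟨m, fun k hk => ?_⟩
  have h1 : θ ^ k ≤ θ ^ m := pow_le_pow_of_le_one hθ0 hθ1.le hk
  have h2 : (θ ^ k) ^ 2 ≤ θ ^ k := by
    have : θ ^ k ≤ 1 := pow_le_one₀ hθ0 hθ1.le
    nlinarith [pow_nonneg hθ0 k]
  have h3 : (θ ^ k) ^ 2 < B / γ := lt_of_le_of_lt (h2.trans h1) hm
  have := (lt_div_iff₀ hγ).mp h3
  linarith

/-- **THE GEOMETRIC MAJORANT (the shape `argBracket_tower` consumes)**: if `δ K ≤ C·θ^K` for all `K ≥ k₁` (`θ > 0`), then ONE constant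
`C₃ ≥ 0` gives `δ K ≤ C₃·θ^K` for ALL `K` — the early cutoffs are finitely many and ride in `C₃ = |C| + Σ_{K<k₁} |δ K|∕θ^K`. [folklore] -/
theorem exists_geometric_majorant {δ : ℕ → ℝ} {C θ : ℝ} {k₁ : ℕ} (hθ : 0 < θ) (h : ∀ K, k₁ ≤ K → δ K ≤ C * θ ^ K) :
    ∃ C₃ : ℝ, 0 ≤ C₃ ∧ ∀ K, δ K ≤ C₃ * θ ^ K := by
  set M : ℝ := ∑ K ∈ Finset.range k₁, |δ K| / θ ^ K with hM
  have hM0 : 0 ≤ M := Finset.sum_nonneg fun K _ => div_nonneg (abs_nonneg _) (pow_nonneg hθ.le K)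
  refine ⟨|C| + M, add_nonneg (abs_nonneg C) hM0, fun K => ?_⟩
  have hθK : 0 < θ ^ K := pow_pos hθ K
  by_cases hK : k₁ ≤ K
  · calc δ K ≤ C * θ ^ K := h K hK
      _ ≤ |C| * θ ^ K := mul_le_mul_of_nonneg_right (le_abs_self C) hθK.le
      _ ≤ (|C| + M) * θ ^ K := mul_le_mul_of_nonneg_right (le_add_of_nonneg_right hM0) hθK.le
  · push Not at hK
    have hmem : K ∈ Finset.range k₁ := Finset.mem_range.mpr hK
    have hle : |δ K| / θ ^ K ≤ M :=
      Finset.single_le_sum (f := fun K => |δ K| / θ ^ K) (fun K _ => div_nonneg (abs_nonneg _) (pow_nonneg hθ.le K)) hmem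
    calc δ K ≤ |δ K| := le_abs_self _
      _ = |δ K| / θ ^ K * θ ^ K := by field_simp
      _ ≤ M * θ ^ K := mul_le_mul_of_nonneg_right hle hθK.le
      _ ≤ (|C| + M) * θ ^ K := mul_le_mul_of_nonneg_right (le_add_of_nonneg_left (abs_nonneg C)) hθK.le

end Generic

/-! ## §2 The four coordinates at GEOMETRIC rate for ONE periodic pair `(W, Z)` on `ℤ⁴` -/

section Pair

variable {n : Type*} [Fintype n] [DecidableEq n]

/-- **POTENTIAL COORDINATE AT RATE `θ^{8k}`** (`θ⁶ = L⁻¹`; (E), (Lip₁), FIT with `l₁`; module docstring): `‖Z x κ‖ ≤ 8l₁²γ·θ^{8k}`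
for EVERY site — i.e. the field-unit potential `a = Z∕ξ` has `‖a‖_∞ ≤ 8l₁²γ·θ^{2k}`. [folklore] -/
theorem norm_dir_le_rate {L N k : ℕ} (hL : 2 ≤ L) (hN : 1 ≤ N) (hk : 1 ≤ k) {θ : ℝ} (hθ : 0 < θ) (hθ6 : θ ^ 6 = ((L : ℝ))⁻¹)
    {W : Site 4 → Fin 4 → (Matrix n n ℂ)ˣ} {Z : Site 4 → Fin 4 → Matrix n n ℂ} (hWP : IsPeriodicCfg W ((N * L ^ k : ℕ) : ℤ))
    (hZP : IsPeriodicDir Z ((N * L ^ k : ℕ) : ℤ)) {γ Λ₁ l₁ : ℝ} (hγ : 0 < γ) (hl₁ : 0 < l₁) (hΛl : Λ₁ ≤ l₁ ^ 3)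
    (hE : (L : ℝ) ^ k * energyNormW L k W Z (periodBox (d := 4) (N * L ^ k)) ≤ γ ^ 3)
    (hlip : ∀ (κ : Fin 4) (x : Site 4) (μ : Fin 4), ‖Z (x + e μ) κ - Z x κ‖ ≤ Λ₁ * (((L : ℝ)⁻¹) ^ k) ^ 2)
    (hfit : γ * (θ ^ k) ^ 2 ≤ l₁ * N) (x : Site 4) (κ : Fin 4) :
    ‖Z x κ‖ ≤ 8 * l₁ ^ 2 * γ * θ ^ (8 * k) := by
  have hL1 : 1 ≤ L := by omega
  obtain ⟨hξ, hLs⟩ := scale_eq hL1 hθ6 k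
  obtain ⟨hhalf, -⟩ := scale_le_half hL hθ hθ6 hk
  set s : ℝ := θ ^ k with hsdef
  have hs : 0 < s := pow_pos hθ k
  set P : ℕ := N * L ^ k with hPdef
  have hP : 1 ≤ P := Nat.one_le_iff_ne_zero.mpr (Nat.mul_ne_zero (by omega) (pow_ne_zero k (by omega)))
  set E := energyNormW L k W Z (periodBox (d := 4) P) with hEdef
  have hlam : 0 ≤ Λ₁ * (((L : ℝ)⁻¹) ^ k) ^ 2 := (norm_nonneg _).trans (hlip κ x 0)
  -- the optimised two-term bound with a = 2 l₁ s⁴, b = γ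
  have ha : 0 < 2 * l₁ * s ^ 4 := by positivity
  have ha3 : 8 * (Λ₁ * (((L : ℝ)⁻¹) ^ k) ^ 2) ≤ (2 * l₁ * s ^ 4) ^ 3 := by
    rw [hξ]
    have : Λ₁ * (s ^ 6) ^ 2 ≤ l₁ ^ 3 * (s ^ 6) ^ 2 := mul_le_mul_of_nonneg_right hΛl (by positivity)
    nlinarith
  have hfit' : γ / (2 * l₁ * s ^ 4) + 1 ≤ ((N * L ^ k : ℕ) : ℝ) := fit_cube hN hs hl₁ hLs hhalf hfit
  have h := le_opt_of_two_term (v := ‖Z x κ‖) (B := (L : ℝ) ^ k * E) ha hγ ha3 hE hfit' fun r hr => by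
    have h' := norm_dir_le_of_energyNormW_periodic hL1 k hP hWP hZP κ hlam (hlip κ) x hr
    push_cast at h'
    linarith
  have e8 : θ ^ (8 * k) = s ^ 8 := by rw [hsdef, ← pow_mul, mul_comm k 8]
  calc ‖Z x κ‖ ≤ 2 * (2 * l₁ * s ^ 4) ^ 2 * γ := h
    _ = 8 * l₁ ^ 2 * γ * θ ^ (8 * k) := by rw [e8]; ring

/-- **CURL COORDINATE AT RATE `θ^{14k}`** ((E), (Lip₂) on the plane `π`, FIT with `l₂`): `‖d_W Z (x, π)‖ ≤ 8l₂²γ·θ^{14k}` for EVERY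
site — ratio `θ^{2k}` to the (1.15) margin `α₀ξ² = α₀θ^{12k}`. [folklore] -/
theorem norm_curl_le_rate {L N k : ℕ} (hL : 2 ≤ L) (hN : 1 ≤ N) (hk : 1 ≤ k) {θ : ℝ} (hθ : 0 < θ) (hθ6 : θ ^ 6 = ((L : ℝ))⁻¹)
    {W : Site 4 → Fin 4 → (Matrix n n ℂ)ˣ} {Z : Site 4 → Fin 4 → Matrix n n ℂ} (hWP : IsPeriodicCfg W ((N * L ^ k : ℕ) : ℤ))
    (hZP : IsPeriodicDir Z ((N * L ^ k : ℕ) : ℤ)) {γ Λ₂ l₂ : ℝ} (hγ : 0 < γ) (hl₂ : 0 < l₂) (hΛl : Λ₂ ≤ l₂ ^ 3)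
    (hE : (L : ℝ) ^ k * energyNormW L k W Z (periodBox (d := 4) (N * L ^ k)) ≤ γ ^ 3)
    (π : T4AveragingDeficitWall.Plane 4)
    (hlip : ∀ (x : Site 4) (μ : Fin 4), ‖curl W Z (x + e μ, π) - curl W Z (x, π)‖ ≤ Λ₂ * (((L : ℝ)⁻¹) ^ k) ^ 3)
    (hfit : γ * (θ ^ k) ^ 2 ≤ l₂ * N) (x : Site 4) :
    ‖curl W Z (x, π)‖ ≤ 8 * l₂ ^ 2 * γ * θ ^ (14 * k) := by
  have hL1 : 1 ≤ L := by omega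
  obtain ⟨hξ, hLs⟩ := scale_eq hL1 hθ6 k
  obtain ⟨hhalf, -⟩ := scale_le_half hL hθ hθ6 hk
  set s : ℝ := θ ^ k with hsdef
  have hs : 0 < s := pow_pos hθ k
  set P : ℕ := N * L ^ k with hPdef
  have hP : 1 ≤ P := Nat.one_le_iff_ne_zero.mpr (Nat.mul_ne_zero (by omega) (pow_ne_zero k (by omega)))
  set E := energyNormW L k W Z (periodBox (d := 4) P) with hEdef
  have hE0 : 0 ≤ E := energyNormW_nonneg L k W Z _
  have hlam : 0 ≤ Λ₂ * (((L : ℝ)⁻¹) ^ k) ^ 3 := (norm_nonneg _).trans (hlip x 0)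
  -- E ≤ γ³ s⁶ since L^k s⁶ = 1
  have hEs : E ≤ (γ * s ^ 2) ^ 3 := by
    have : E = s ^ 6 * ((L : ℝ) ^ k * E) := by
      rw [← mul_assoc, mul_comm (s ^ 6), hLs, one_mul]
    rw [this]
    calc s ^ 6 * ((L : ℝ) ^ k * E) ≤ s ^ 6 * γ ^ 3 := mul_le_mul_of_nonneg_left hE (by positivity)
      _ = (γ * s ^ 2) ^ 3 := by ring
  -- the optimised two-term bound with a' = 2 l₂ s⁶, b' = γ s²
  have ha : 0 < 2 * l₂ * s ^ 6 := by positivity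
  have hb : 0 < γ * s ^ 2 := by positivity
  have ha3 : 8 * (Λ₂ * (((L : ℝ)⁻¹) ^ k) ^ 3) ≤ (2 * l₂ * s ^ 6) ^ 3 := by
    rw [hξ]
    have : Λ₂ * (s ^ 6) ^ 3 ≤ l₂ ^ 3 * (s ^ 6) ^ 3 := mul_le_mul_of_nonneg_right hΛl (by positivity)
    nlinarith
  have hfit' : γ * s ^ 2 / (2 * l₂ * s ^ 6) + 1 ≤ ((N * L ^ k : ℕ) : ℝ) := by
    have e1 : γ * s ^ 2 / (2 * l₂ * s ^ 6) = γ / (2 * l₂ * s ^ 4) := by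
      field_simp
    rw [e1]
    exact fit_cube hN hs hl₂ hLs hhalf hfit
  have h := le_opt_of_two_term (v := ‖curl W Z (x, π)‖) (B := E) ha hb ha3 hEs hfit' fun r hr => by
    have h' := norm_curl_le_of_energyNormW_periodic L k hP hWP hZP π hlam hlip x hr
    push_cast at h'
    linarith
  have e14 : θ ^ (14 * k) = s ^ 14 := by rw [hsdef, ← pow_mul, mul_comm k 14]
  calc ‖curl W Z (x, π)‖ ≤ 2 * (2 * l₂ * s ^ 6) ^ 2 * (γ * s ^ 2) := h
    _ = 8 * l₂ ^ 2 * γ * θ ^ (14 * k) := by rw [e14]; ring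

/-- **GRADIENT COORDINATE AT RATE `θ^{13k}`** ((E), (Lip₁), (Lip₂′) with `Λ₂′ > 0`, FIT with `l₁`; discrete Landau–Kolmogorov on top of
`norm_dir_le_rate`): `‖Z (x + e μ) κ − Z x κ‖ ≤ 4l₁√(2γΛ₂′)·θ^{13k}` — ratio `θ^{k}` to the field-unit gradient margin `ξ² = θ^{12k}`.
(Plain forward differences; the (1.13) gradient is the covariant `∇_W`, equal up to `2‖W − 1‖·‖Z‖` — NODE O's reading.) [folklore] -/
theorem norm_dirDiff_le_rate {L N k : ℕ} (hL : 2 ≤ L) (hN : 1 ≤ N) (hk : 1 ≤ k) {θ : ℝ} (hθ : 0 < θ)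
    (hθ6 : θ ^ 6 = ((L : ℝ))⁻¹) {W : Site 4 → Fin 4 → (Matrix n n ℂ)ˣ} {Z : Site 4 → Fin 4 → Matrix n n ℂ}
    (hWP : IsPeriodicCfg W ((N * L ^ k : ℕ) : ℤ)) (hZP : IsPeriodicDir Z ((N * L ^ k : ℕ) : ℤ)) {γ Λ₁ l₁ Λ₂' : ℝ} (hγ : 0 < γ)
    (hl₁ : 0 < l₁) (hΛl : Λ₁ ≤ l₁ ^ 3) (hΛ₂' : 0 < Λ₂')
    (hE : (L : ℝ) ^ k * energyNormW L k W Z (periodBox (d := 4) (N * L ^ k)) ≤ γ ^ 3)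
    (hlip : ∀ (κ : Fin 4) (x : Site 4) (μ : Fin 4), ‖Z (x + e μ) κ - Z x κ‖ ≤ Λ₁ * (((L : ℝ)⁻¹) ^ k) ^ 2)
    (hlip2 : ∀ (κ μ : Fin 4) (y : Site 4),
      ‖(Z (y + (2 : ℕ) • e μ) κ - Z (y + e μ) κ) - (Z (y + e μ) κ - Z y κ)‖ ≤ Λ₂' * (((L : ℝ)⁻¹) ^ k) ^ 3)
    (hfit : γ * (θ ^ k) ^ 2 ≤ l₁ * N) (x : Site 4) (μ κ : Fin 4) :
    ‖Z (x + e μ) κ - Z x κ‖ ≤ 4 * l₁ * Real.sqrt (2 * γ * Λ₂') * θ ^ (13 * k) := by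
  have hL1 : 1 ≤ L := by omega
  obtain ⟨hξ, -⟩ := scale_eq hL1 hθ6 k
  set s : ℝ := θ ^ k with hsdef
  have hs : 0 < s := pow_pos hθ k
  have hsup : ∀ y, ‖Z y κ‖ ≤ 8 * l₁ ^ 2 * γ * θ ^ (8 * k) := fun y =>
    norm_dir_le_rate hL hN hk hθ hθ6 hWP hZP hγ hl₁ hΛl hE hlip hfit y κ
  have hM0 : 0 < 8 * l₁ ^ 2 * γ * θ ^ (8 * k) := by positivity
  have hl2 : 0 < Λ₂' * (((L : ℝ)⁻¹) ^ k) ^ 3 := by rw [hξ]; positivity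
  have h := norm_fwdDiff_le_two_sqrt (fun y => Z y κ) μ hM0 hl2 hsup (hlip2 κ μ) x
  have e8 : θ ^ (8 * k) = s ^ 8 := by rw [hsdef, ← pow_mul, mul_comm k 8]
  have e13 : θ ^ (13 * k) = s ^ 13 := by rw [hsdef, ← pow_mul, mul_comm k 13]
  have hsq : Real.sqrt (8 * l₁ ^ 2 * γ * θ ^ (8 * k) * (Λ₂' * (((L : ℝ)⁻¹) ^ k) ^ 3))
      = 2 * l₁ * s ^ 13 * Real.sqrt (2 * γ * Λ₂') := by
    rw [e8, hξ]
    have e1 : 8 * l₁ ^ 2 * γ * s ^ 8 * (Λ₂' * (s ^ 6) ^ 3) = (2 * l₁ * s ^ 13) ^ 2 * (2 * γ * Λ₂') := by ring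
    rw [e1, Real.sqrt_mul (sq_nonneg _), Real.sqrt_sq (by positivity)]
  calc ‖Z (x + e μ) κ - Z x κ‖ ≤ 2 * Real.sqrt (8 * l₁ ^ 2 * γ * θ ^ (8 * k) * (Λ₂' * (((L : ℝ)⁻¹) ^ k) ^ 3)) := h
    _ = 4 * l₁ * Real.sqrt (2 * γ * Λ₂') * θ ^ (13 * k) := by rw [hsq, e13]; ring

/-- **PLAQUETTE COORDINATE AT RATE `θ^{14k}`** (`W` unitary, `Z` skew; (E), (Lip₁) with `l₁`, (Lip₂) on the plane `μ < ν` with `l₂`, both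
FITs): `‖(W e^Z)(∂p) − W(∂p)‖ ≤ (8l₂²γ + 1536·l₁⁴γ²·e^{8l₁²γ})·θ^{14k}` at the plaquette `p = (z; μ < ν)` — ratio `θ^{2k}` to the (1.14)
margin `α₀ξ²`.  The NE3 crew's one-configuration calculus `norm_hol_vary_sub_hol_le_curl` is fed OUR sup bound `norm_dir_le_rate` as its
`α` (so T-E_w♯'s sup conjunct is not used) and `e^α − 1 ≤ αe^α`. [folklore] -/
theorem norm_hol_sub_le_rate [Nonempty n] {L N k : ℕ} (hL : 2 ≤ L) (hN : 1 ≤ N) (hk : 1 ≤ k) {θ : ℝ} (hθ : 0 < θ)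
    (hθ6 : θ ^ 6 = ((L : ℝ))⁻¹) {W : Site 4 → Fin 4 → (Matrix n n ℂ)ˣ} {Z : Site 4 → Fin 4 → Matrix n n ℂ}
    (hWu : IsUnitaryCfg W) (hZs : IsSkewDir Z) (hWP : IsPeriodicCfg W ((N * L ^ k : ℕ) : ℤ))
    (hZP : IsPeriodicDir Z ((N * L ^ k : ℕ) : ℤ)) {γ Λ₁ l₁ Λ₂ l₂ : ℝ} (hγ : 0 < γ) (hl₁ : 0 < l₁) (hΛl₁ : Λ₁ ≤ l₁ ^ 3)
    (hl₂ : 0 < l₂) (hΛl₂ : Λ₂ ≤ l₂ ^ 3)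
    (hE : (L : ℝ) ^ k * energyNormW L k W Z (periodBox (d := 4) (N * L ^ k)) ≤ γ ^ 3)
    (hlip : ∀ (κ : Fin 4) (x : Site 4) (μ : Fin 4), ‖Z (x + e μ) κ - Z x κ‖ ≤ Λ₁ * (((L : ℝ)⁻¹) ^ k) ^ 2)
    (z : Site 4) {μ ν : Fin 4} (hμν : μ < ν)
    (hlip' : ∀ (x : Site 4) (ρ : Fin 4),
      ‖curl W Z (x + e ρ, ⟨(μ, ν), hμν⟩) - curl W Z (x, ⟨(μ, ν), hμν⟩)‖ ≤ Λ₂ * (((L : ℝ)⁻¹) ^ k) ^ 3)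
    (hfit₁ : γ * (θ ^ k) ^ 2 ≤ l₁ * N) (hfit₂ : γ * (θ ^ k) ^ 2 ≤ l₂ * N) :
    ‖((hol (vary W Z 1) z (plaqWord μ ν) : (Matrix n n ℂ)ˣ) : Matrix n n ℂ)
        - ((hol W z (plaqWord μ ν) : (Matrix n n ℂ)ˣ) : Matrix n n ℂ)‖
      ≤ (8 * l₂ ^ 2 * γ + 1536 * l₁ ^ 4 * γ ^ 2 * Real.exp (8 * l₁ ^ 2 * γ)) * θ ^ (14 * k) := by
  obtain ⟨-, hs1⟩ := scale_le_half hL hθ hθ6 hk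
  set s : ℝ := θ ^ k with hsdef
  have hs : 0 < s := pow_pos hθ k
  set α : ℝ := 8 * l₁ ^ 2 * γ * θ ^ (8 * k) with hαdef
  have hsup : ∀ x κ, ‖Z x κ‖ ≤ α := fun x κ =>
    norm_dir_le_rate hL hN hk hθ hθ6 hWP hZP hγ hl₁ hΛl₁ hE hlip hfit₁ x κ
  have hcurl : ‖curlAt W Z z μ ν‖ ≤ 8 * l₂ ^ 2 * γ * θ ^ (14 * k) :=
    norm_curl_le_rate hL hN hk hθ hθ6 hWP hZP hγ hl₂ hΛl₂ hE ⟨(μ, ν), hμν⟩ hlip' hfit₂ z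
  have h0 := norm_hol_vary_sub_hol_le_curl hWu hZs hsup (t := (1 : ℝ)) zero_le_one z μ ν
  rw [one_mul, one_mul] at h0
  have e8 : θ ^ (8 * k) = s ^ 8 := by rw [hsdef, ← pow_mul, mul_comm k 8]
  have e14 : θ ^ (14 * k) = s ^ 14 := by rw [hsdef, ← pow_mul, mul_comm k 14]
  have hα0 : 0 ≤ α := by positivity
  have hαs : α = 8 * l₁ ^ 2 * γ * s ^ 8 := by rw [hαdef, e8]
  -- α ≤ 8 l₁² γ (s ≤ 1)
  have hs8 : s ^ 8 ≤ 1 := pow_le_one₀ hs.le hs1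
  have hαle : α ≤ 8 * l₁ ^ 2 * γ := by
    rw [hαs]
    have : 8 * l₁ ^ 2 * γ * s ^ 8 ≤ 8 * l₁ ^ 2 * γ * 1 := mul_le_mul_of_nonneg_left hs8 (by positivity)
    linarith
  -- e^α − 1 ≤ α e^α ≤ α e^{8 l₁² γ}
  -- e^α − 1 ≤ α e^α (1 − α ≤ e^{−α}; the tree's `AreaLaw.exp_sub_one_le_mul_exp`, re-derived inline to keep the imports light)
  have hexp1 : Real.exp α - 1 ≤ α * Real.exp α := by
    have h := Real.add_one_le_exp (-α)
    have h1 : Real.exp α * Real.exp (-α) = 1 := by rw [← Real.exp_add, add_neg_cancel, Real.exp_zero]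
    nlinarith [mul_le_mul_of_nonneg_left h (Real.exp_pos α).le, Real.exp_pos α]
  have hexp : Real.exp α - 1 ≤ α * Real.exp (8 * l₁ ^ 2 * γ) :=
    hexp1.trans (mul_le_mul_of_nonneg_left (Real.exp_le_exp.mpr hαle) hα0)
  have hexp0 : 0 ≤ Real.exp α - 1 := by have := Real.add_one_le_exp α; linarith
  have hL1 : bondL1At Z z μ ν ≤ 4 * α := by
    unfold bondL1At
    have := hsup z μ; have := hsup (z + e μ) ν; have := hsup (z + e ν) μ; have := hsup z ν
    linarith
  have hL10 : 0 ≤ bondL1At Z z μ ν := bondL1At_nonneg Z z μ ν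
  -- the second term: 6 (e^α − 1) bondL1 ≤ 6 · α e^{8l₁²γ} · 4α = 24 α² e^{…} ≤ 1536 l₁⁴ γ² e^{…} s^14
  have h2 : 6 * (Real.exp α - 1) * bondL1At Z z μ ν ≤ 6 * (α * Real.exp (8 * l₁ ^ 2 * γ)) * (4 * α) :=
    mul_le_mul (mul_le_mul_of_nonneg_left hexp (by norm_num)) hL1 hL10 (by positivity)
  have hs16 : s ^ 16 ≤ s ^ 14 := pow_le_pow_of_le_one hs.le hs1 (by norm_num)
  have hex0 : 0 ≤ Real.exp (8 * l₁ ^ 2 * γ) := (Real.exp_pos _).le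
  have h3 : 6 * (α * Real.exp (8 * l₁ ^ 2 * γ)) * (4 * α) ≤ 1536 * l₁ ^ 4 * γ ^ 2 * Real.exp (8 * l₁ ^ 2 * γ) * s ^ 14 := by
    rw [hαs]
    have e1 : 6 * (8 * l₁ ^ 2 * γ * s ^ 8 * Real.exp (8 * l₁ ^ 2 * γ)) * (4 * (8 * l₁ ^ 2 * γ * s ^ 8))
        = 1536 * l₁ ^ 4 * γ ^ 2 * Real.exp (8 * l₁ ^ 2 * γ) * s ^ 16 := by ring
    rw [e1]
    exact mul_le_mul_of_nonneg_left hs16 (by positivity)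
  calc ‖((hol (vary W Z 1) z (plaqWord μ ν) : (Matrix n n ℂ)ˣ) : Matrix n n ℂ)
          - ((hol W z (plaqWord μ ν) : (Matrix n n ℂ)ˣ) : Matrix n n ℂ)‖
        ≤ ‖curlAt W Z z μ ν‖ + 6 * (Real.exp α - 1) * bondL1At Z z μ ν := h0
    _ ≤ 8 * l₂ ^ 2 * γ * θ ^ (14 * k) + 1536 * l₁ ^ 4 * γ ^ 2 * Real.exp (8 * l₁ ^ 2 * γ) * s ^ 14 :=
        add_le_add hcurl (h2.trans h3)
    _ = (8 * l₂ ^ 2 * γ + 1536 * l₁ ^ 4 * γ ^ 2 * Real.exp (8 * l₁ ^ 2 * γ)) * θ ^ (14 * k) := by rw [e14]; ring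

end Pair

/-! ## §3 The energy budget at `d = 4` is k-free: T-E_w's `E ≤ C·R_k` gives (E) with `γ³ = C·ρ₄` -/

section Budget

/-- **(E) FROM T-E_w's ENERGY CONJUNCT**: `E ≤ C·residualScale 4 L N b g k`, `C ≥ 0`, `g ≥ 0`, `L ≥ 1` ⇒
`L^k·E ≤ C·ρ₄` with `ρ₄ = wallConst 4 L·N²·(√g·dualC2 + 2b²·dualC1)` — a k-FREE budget (`residualScale_four_le`); any `γ` with
`C·ρ₄ ≤ γ³` then serves §2 at every level. [folklore] -/
theorem energy_budget_of_residualScale {L : ℕ} (hL : 1 ≤ L) (N : ℕ) (b : ℝ) {g C E : ℝ} (hg : 0 ≤ g) (hC : 0 ≤ C) (k : ℕ)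
    (hE : E ≤ C * residualScale 4 L N b g k) :
    (L : ℝ) ^ k * E ≤ C * (wallConst 4 L * (N : ℝ) ^ 2 * (Real.sqrt g * dualC2 4 L + 2 * b ^ 2 * dualC1 4 L)) := by
  have hL0 : (0 : ℝ) < (L : ℝ) := by exact_mod_cast (by omega : 0 < L)
  have hLk : 0 < (L : ℝ) ^ k := pow_pos hL0 k
  have hR := residualScale_four_le hL N b hg k
  have h1 : (L : ℝ) ^ k * ((L : ℝ)⁻¹) ^ k = 1 := by
    rw [← mul_pow, mul_inv_cancel₀ hL0.ne', one_pow]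
  calc (L : ℝ) ^ k * E ≤ (L : ℝ) ^ k * (C * residualScale 4 L N b g k) := mul_le_mul_of_nonneg_left hE hLk.le
    _ ≤ (L : ℝ) ^ k * (C * (wallConst 4 L * (N : ℝ) ^ 2 * (Real.sqrt g * dualC2 4 L + 2 * b ^ 2 * dualC1 4 L)
          * ((L : ℝ)⁻¹) ^ k)) :=
        mul_le_mul_of_nonneg_left (mul_le_mul_of_nonneg_left hR hC) hLk.le
    _ = C * (wallConst 4 L * (N : ℝ) ^ 2 * (Real.sqrt g * dualC2 4 L + 2 * b ^ 2 * dualC1 4 L))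
          * ((L : ℝ) ^ k * ((L : ℝ)⁻¹) ^ k) := by ring
    _ = C * (wallConst 4 L * (N : ℝ) ^ 2 * (Real.sqrt g * dualC2 4 L + 2 * b ^ 2 * dualC1 4 L)) := by rw [h1, mul_one]

end Budget

end

end Summit.QuantumFields.BalabanUV.T4Continuum.NE7EtaRatesD4
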